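import Literature.Barriers.NavierStokesRegularity.NavierStokesInequalityArrangement
import Literature.Analysis.FluidPDE.NormalisedPressureAffine
import HarnessLib

/-!
# Axial translates of Scheffer's structures (Ożański 2017, §6.3 Step 1)

Support file on the discharge path of fact D′
`Literature.Barriers.NavierStokesRegularity.NSICantorBlock_of_arrangement` (the level data of a
geometric arrangement for Theorem 14 = Ożański's Proposition 16, `NavierStokesInequalityCantorArrangement`).
The proof of Proposition 16 (W. S. Ożański, arXiv:1709.00602v4, §6.3) begins with **Step 1**
(p. 30): "We renumber the functions … and let
`f_i^𝔪(x₁,x₂) := f_i(π_m⁻¹(τʲx₁), x₂)`, `v_i^𝔪(x₁,x₂) := v_i(π_m⁻¹(τʲx₁), x₂)`,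
`φ_i^𝔪(x₁,x₂) := φ_i(π_m⁻¹(τʲx₁), x₂)`, `U_i^𝔪 := {(x₁,x₂) : (π_m⁻¹(τʲx₁), x₂) ∈ U_i}`. Then …
`(v_i^𝔪, f_i^𝔪, φ_i^𝔪)` and `(v_i^𝔪, h_{i,t}^𝔪, φ_i^𝔪)` are structures on `U_i^𝔪` … and the sets
`K^𝔪` are pairwise disjoint translates of `Ū₁ ∪ Ū₂` in the `x₁` direction" — since
`π_m⁻¹(τʲx₁) = x₁ - τ^{-j}π_m(0)`, each `U_i^𝔪` is the translate of `U_i` along the symmetry axis by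
`τ^{-j}π_m(0)` (the tree's `levelShift`, `NavierStokesInequalityCantorArrangement`). This file PROVES
that axial translation preserves everything the construction uses:

* `IsNSIStructure.comp_add_axial` — **the axial translate of a structure is a structure**
  (Definition 3.3 is invariant under `(r,z) ↦ (r, z+s)`: the half-plane, `div(x₂v)`, `|v| < f` and
  Scheffer's operator `L` only see the distance `r` to the axis);
* `swirlField_comp_add_axial`, `normalisedPressure_swirlField_comp_add_axial`,
  `planePressure_comp_add_axial`, `pressureInteraction_comp_add_axial` — the fields `u[v,f]`,
  their pressure functions `p*[v,f]`, `p[v,f]` and the interaction `F[v,f]` of the translated data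
  are the translates (Ożański Lemma 3.1/3.2 are translation covariant; the Riesz transforms
  commute with translations, `normalisedPressure_comp_affine`).

Dictionary as in `NavierStokesInequalityArrangement`: plane points `q = (r, z)` with `z` axial
(Ożański's `x₁`), so his translation "in the `x₁` direction" by `s` is `q ↦ q + (0, s)` in the plane
and `x ↦ x + s • eZ` in space.

## References

* W. S. Ożański, arXiv:1709.00602v4 (2017/2019), §6.3 Step 1 ((6.19)–(6.22)); Definition 3.3,
  Lemmas 3.1–3.2. [`Ozanski2017NSISingular`]
* V. Scheffer, Comm. Math. Phys. 110 (1987), §5, (5.26)–(5.33) (the configurations `Z`).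
  [`Scheffer1987`]
-/

noncomputable section

open Set Function Filter Topology
open scoped ContDiff

namespace Literature.Barriers.NavierStokesRegularity

open Literature.Analysis.FluidPDE

/-! ### Axial translations in space and in the meridian plane -/

/-- The cylindrical radius is invariant under axial translations. [folklore] -/
theorem cylRadius_add_smul_eZ (x : EuclideanSpace ℝ (Fin 3)) (s : ℝ) : cylRadius (x + s • eZ) = cylRadius x := by
  simp [cylRadius, eZ]

/-- The radial frame vector is invariant under axial translations. [folklore] -/
theorem eR_add_smul_eZ (x : EuclideanSpace ℝ (Fin 3)) (s : ℝ) : eR (x + s • eZ) = eR x := by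
  rw [eR, eR, cylRadius_add_smul_eZ]
  congr 2
  simp [eZ]

/-- The angular frame vector is invariant under axial translations. [folklore] -/
theorem eTheta_add_smul_eZ (x : EuclideanSpace ℝ (Fin 3)) (s : ℝ) : eTheta (x + s • eZ) = eTheta x := by
  rw [eTheta, eTheta, cylRadius_add_smul_eZ]
  congr 2
  simp [eZ]

/-- The meridian projection intertwines the axial translations: `R⁻¹(x + s eZ) = R⁻¹x + (0, s)`. [folklore] -/
theorem meridian_add_smul_eZ (x : EuclideanSpace ℝ (Fin 3)) (s : ℝ) : meridian (x + s • eZ) = meridian x + (0, s) := by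
  rw [meridian_apply, meridian_apply, cylRadius_add_smul_eZ]
  ext <;> simp [eZ]

/-- The meridian embedding intertwines the axial translations: `(r, 0, z + s) = (r, 0, z) + s eZ`. [folklore] -/
theorem meridianPoint_add (q : ℝ × ℝ) (s : ℝ) :
    meridianPoint (q + (0, s)) = meridianPoint q + s • eZ := by
  ext i
  fin_cases i <;> simp [meridianPoint, eZ]

/-! ### The fields of translated planar data -/

/-- **`u[v,f]` of axially translated data is the axial translate of `u[v,f]`**:
`u[v(· + (0,s)), f(· + (0,s))](x) = u[v,f](x + s eZ)` (the frame `(e_r, e_θ, e_z)` and the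
meridian projection commute with axial translations; Ożański §6.3 Step 1).
[cite: Ozanski2017NSISingular, §6.3 Step 1] -/
theorem swirlField_comp_add_axial (v : ℝ × ℝ → ℝ × ℝ) (f : ℝ × ℝ → ℝ) (s : ℝ) (x : EuclideanSpace ℝ (Fin 3)) :
    swirlField (fun q => v (q + (0, s))) (fun q => f (q + (0, s))) x = swirlField v f (x + s • eZ) := by
  simp only [swirlField, meridian_add_smul_eZ, eR_add_smul_eZ, eTheta_add_smul_eZ]

/-- Function form of `swirlField_comp_add_axial`, in the shape of the affine covariance lemmas. [folklore] -/
theorem swirlField_comp_add_axial' (v : ℝ × ℝ → ℝ × ℝ) (f : ℝ × ℝ → ℝ) (s : ℝ) :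
    swirlField (fun q => v (q + (0, s))) (fun q => f (q + (0, s))) =
      fun x => swirlField v f (s • eZ + (1 : ℝ) • x) := by
  funext x
  rw [swirlField_comp_add_axial, one_smul, add_comm]

/-- **The pressure function of translated data is the translate of the pressure function**:
`p*[v(·+(0,s)), f(·+(0,s))](x) = p*[v,f](x + s eZ)` (the Riesz transforms commute with
translations, `normalisedPressure_comp_affine` with ratio `1`).
[cite: Ozanski2017NSISingular, §6.3 Step 1 and Lemma 3.2] -/
theorem normalisedPressure_swirlField_comp_add_axial (v : ℝ × ℝ → ℝ × ℝ) (f : ℝ × ℝ → ℝ) (s : ℝ)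
    (x : EuclideanSpace ℝ (Fin 3)) :
    normalisedPressure (swirlField (fun q => v (q + (0, s))) (fun q => f (q + (0, s)))) x =
      normalisedPressure (swirlField v f) (x + s • eZ) := by
  rw [swirlField_comp_add_axial', normalisedPressure_comp_affine (swirlField v f) (s • eZ) one_pos x,
    one_smul, add_comm]

/-- **The planar pressure of translated data**: `p[v(·+(0,s)), f(·+(0,s))](q) = p[v,f](q + (0,s))`.
[cite: Ozanski2017NSISingular, §6.3 Step 1 and (3.20)] -/
theorem planePressure_comp_add_axial (v : ℝ × ℝ → ℝ × ℝ) (f : ℝ × ℝ → ℝ) (s : ℝ) (q : ℝ × ℝ) :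
    planePressure (fun q => v (q + (0, s))) (fun q => f (q + (0, s))) q =
      planePressure v f (q + (0, s)) := by
  rw [planePressure, planePressure, normalisedPressure_swirlField_comp_add_axial, meridianPoint_add]

/-! ### Planar derivatives of translates -/

/-- `∂ᵣ` commutes with translations: `∂ᵣ(g(· + c))(q) = (∂ᵣg)(q + c)` (unconditionally). [folklore] -/
theorem derivR_comp_add {F : Type*} [NormedAddCommGroup F] [NormedSpace ℝ F] (g : ℝ × ℝ → F)
    (c q : ℝ × ℝ) : derivR (fun q' => g (q' + c)) q = derivR g (q + c) := by
  simp only [derivR, fderiv_comp_add_right]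

/-- `∂_z` commutes with translations. [folklore] -/
theorem derivZ_comp_add {F : Type*} [NormedAddCommGroup F] [NormedSpace ℝ F] (g : ℝ × ℝ → F)
    (c q : ℝ × ℝ) : derivZ (fun q' => g (q' + c)) q = derivZ g (q + c) := by
  simp only [derivZ, fderiv_comp_add_right]

/-- Function forms. [folklore] -/
theorem derivR_comp_add' {F : Type*} [NormedAddCommGroup F] [NormedSpace ℝ F] (g : ℝ × ℝ → F)
    (c : ℝ × ℝ) : derivR (fun q' => g (q' + c)) = fun q => derivR g (q + c) :=
  funext (derivR_comp_add g c)

/-- Function forms. [folklore] -/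
theorem derivZ_comp_add' {F : Type*} [NormedAddCommGroup F] [NormedSpace ℝ F] (g : ℝ × ℝ → F)
    (c : ℝ × ℝ) : derivZ (fun q' => g (q' + c)) = fun q => derivZ g (q + c) :=
  funext (derivZ_comp_add g c)

/-- **Scheffer's operator `L` commutes with AXIAL translations** (`c = (0, s)`; the coefficients
`x₂⁻¹`, `x₂⁻²` of (3.15) only involve the distance to the axis). [cite: Ozanski2017NSISingular, §3.3 (3.15)] -/
theorem opL_comp_add_axial (f : ℝ × ℝ → ℝ) (s : ℝ) (q : ℝ × ℝ) :
    opL (fun q' => f (q' + (0, s))) q = opL f (q + (0, s)) := by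
  simp only [opL, derivR_comp_add', derivZ_comp_add', derivR_comp_add, derivZ_comp_add,
    Prod.fst_add, add_zero]

/-- **The pressure interaction of translated data**: `F[v(·+(0,s)), f(·+(0,s))](q) = F[v,f](q + (0,s))`.
[cite: Ozanski2017NSISingular, §6.3 Step 1 and (3.34)] -/
theorem pressureInteraction_comp_add_axial (v : ℝ × ℝ → ℝ × ℝ) (f : ℝ × ℝ → ℝ) (s : ℝ)
    (q : ℝ × ℝ) :
    pressureInteraction (fun q => v (q + (0, s))) (fun q => f (q + (0, s))) q =
      pressureInteraction v f (q + (0, s)) := by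
  have h0 : planePressure (0 : ℝ × ℝ → ℝ × ℝ) (fun q => f (q + (0, s))) =
      fun q => planePressure 0 f (q + (0, s)) := by
    funext q'
    exact planePressure_comp_add_axial (0 : ℝ × ℝ → ℝ × ℝ) f s q'
  have h1 : planePressure (fun q => v (q + (0, s))) (fun q => f (q + (0, s))) =
      fun q => planePressure v f (q + (0, s)) :=
    funext (planePressure_comp_add_axial v f s)
  simp only [pressureInteraction, h0, h1, derivR_comp_add, derivZ_comp_add]

/-! ### Translated structures (Ożański 2017, §6.3 Step 1) -/

/-- Topological supports of translates: `tsupport (g(· + c)) = (· + c)⁻¹' tsupport g`. [folklore] -/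
theorem tsupport_comp_add {F : Type*} [Zero F] (g : ℝ × ℝ → F) (c : ℝ × ℝ) :
    tsupport (fun q => g (q + c)) = (fun q => q + c) ⁻¹' tsupport g := by
  have h2 := (Homeomorph.addRight c).preimage_closure (support g)
  rw [Homeomorph.coe_addRight] at h2
  have h3 : support (fun q => g (q + c)) = (fun q => q + c) ⁻¹' support g :=
    support_comp_eq_preimage g _
  rw [tsupport, tsupport, h3]
  exact h2.symm

/-- Closures of translates: `closure ((· + c)⁻¹' U) = (· + c)⁻¹' closure U`. [folklore] -/
theorem closure_preimage_add (U : Set (ℝ × ℝ)) (c : ℝ × ℝ) :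
    closure ((fun q => q + c) ⁻¹' U) = (fun q => q + c) ⁻¹' closure U :=
  ((Homeomorph.addRight c).preimage_closure U).symm

namespace IsNSIStructure

variable {U : Set (ℝ × ℝ)} {v : ℝ × ℝ → ℝ × ℝ} {f φ : ℝ × ℝ → ℝ}

/-- **The axial translate of a structure is a structure** (Ożański 2017, §6.3 Step 1:
"`(v_i^𝔪, f_i^𝔪, φ_i^𝔪)` … are structures on `U_i^𝔪`", `U_i^𝔪 = {(x₁,x₂) : (π_m⁻¹(τʲx₁), x₂) ∈ U_i}`
the translate of `U_i` along the axis): if `(v, f, φ)` is a structure on `U`, then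
`(v(·+(0,s)), f(·+(0,s)), φ(·+(0,s)))` is a structure on `{q : q + (0,s) ∈ U}` — every clause of
Definition 3.3 is invariant, the half-plane, `div(x₂ v)`, and `L` seeing only the distance to the
axis. [cite: Ozanski2017NSISingular, §6.3 Step 1 and Definition 3.3] -/
theorem comp_add_axial (h : IsNSIStructure U v f φ) (s : ℝ) :
    IsNSIStructure ((fun q => q + (0, s)) ⁻¹' U) (fun q => v (q + (0, s)))
      (fun q => f (q + (0, s))) (fun q => φ (q + (0, s))) where
  isOpen := h.isOpen.preimage (continuous_id.add continuous_const)
  isCompact_closure := by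
    rw [closure_preimage_add]
    exact (Homeomorph.addRight ((0 : ℝ), s)).isCompact_preimage.2 h.isCompact_closure
  closure_subset := by
    rw [closure_preimage_add]
    intro q hq
    have := h.closure_subset hq
    simp only [halfPlane, mem_setOf_eq, Prod.fst_add, add_zero] at this ⊢
    exact this
  v_smooth := h.v_smooth.comp (contDiff_id.add contDiff_const)
  f_smooth := h.f_smooth.comp (contDiff_id.add contDiff_const)
  φ_smooth := h.φ_smooth.comp (contDiff_id.add contDiff_const)
  f_nonneg q := h.f_nonneg _
  φ_mem q := h.φ_mem _
  tsupport_f := by rw [tsupport_comp_add, h.tsupport_f, closure_preimage_add]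
  tsupport_φ := by
    rw [tsupport_comp_add]
    exact preimage_mono h.tsupport_φ
  tsupport_v := by
    rw [tsupport_comp_add]
    exact preimage_mono h.tsupport_v
  div_eq_zero q hq := by
    have e1 : (fun q' : ℝ × ℝ => q'.1 * (v (q' + (0, s))).1) =
        fun q' => (fun p : ℝ × ℝ => p.1 * (v p).1) (q' + (0, s)) := by
      funext q'; simp
    have e2 : (fun q' : ℝ × ℝ => q'.1 * (v (q' + (0, s))).2) =
        fun q' => (fun p : ℝ × ℝ => p.1 * (v p).2) (q' + (0, s)) := by
      funext q'; simp
    rw [e1, e2, derivR_comp_add (fun p : ℝ × ℝ => p.1 * (v p).1) (0, s) q,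
      derivZ_comp_add (fun p : ℝ × ℝ => p.1 * (v p).2) (0, s) q]
    exact h.div_eq_zero _ hq
  sq_lt q hq := h.sq_lt _ hq
  opL_pos q hq hφ := by
    rw [opL_comp_add_axial]
    exact h.opL_pos _ hq hφ

end IsNSIStructure

/-- **The translate of a structure's solid**: `R({q : q + (0,s) ∈ Ū}) = {x : x + s eZ ∈ R(Ū)}`,
i.e. the support `R(K^𝔪)` of the translated field is the axial translate of `R(Ū)` (Ożański
(6.22): "the sets `K^𝔪` are pairwise disjoint translates … in the `x₁` direction").
[cite: Ozanski2017NSISingular, §6.3 Step 1 (6.22)] -/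
theorem revolve_preimage_add_axial (K : Set (ℝ × ℝ)) (s : ℝ) :
    revolve ((fun q => q + (0, s)) ⁻¹' K) = (fun x : EuclideanSpace ℝ (Fin 3) => x + s • eZ) ⁻¹' revolve K := by
  ext x
  simp only [mem_revolve, mem_preimage, meridian_add_smul_eZ]

end Literature.Barriers.NavierStokesRegularity
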